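import Literature.AlgebraicGeometry.GroupSchemes.FiniteFlatGroupSchemeRankPointCount
import HarnessLib

/-!
# Closer for `stub_b1cg_rankEqCardMulRank_geom` (ED. 2) and `stub_b1c_rankEqCardMulRank` (ED. 1) of `Cruxes/HLiu418/Lines/F0_P6b_ConnectedEtale.lean` (σ2)

Summit-side THEOREM file (cell `pub/hodgecm-mathlib`, FLOOR 0, P6 «MOD programme», sub-line P6b «CONNECTED–ÉTALE», desk F0P6b-plan (g0) deal
2026-09-01T13:48:36Z; prover F0P3a-p04 (g15), strategy σ2 «DEGREE = Σ OVER THE SPECIAL FIBRE»; `--supports stmt-HodgeConjecture-24832` (HLiu418)).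
TWO theorems whose TYPES are the texts of the stubs `stub_b1cg_rankEqCardMulRank_geom` (ED. 2 cand v2 dca78db9913a38aa :109) and
`stub_b1c_rankEqCardMulRank` (tree ED. 1 8210ab19d71568b2 :100) with the line's predicate
`IsUnitComponent G G₀ j := IsMonHom j ∧ IsOpenImmersion j.left ∧ IsClosedImmersion j.left ∧ ConnectedSpace G₀.left` UNFOLDED (a `Theorems`
file may not import a `Cruxes/…/Lines` workfile; the desk folds `stub_… := <this>` by `exact`, δ-unfolding, as for ★ `F0P6bConnectedEtaleStubB1a`).
PROOF = ★ `Literature.AlgebraicGeometry.GroupSchemes.finrank_eq_natCard_points_mul_finrank_geom` ∕ `…_finrank`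
(`GroupSchemes/FiniteFlatGroupSchemeRankPointCount`: ANY unit component is `Spec` of the unit corner; `k`-points are `R`-algebra maps `Γ(G) → k`)
over ★ `Literature.RingTheory.Henselian.finrank_eq_natCard_algHom_mul_finrank_unitCorner` (`Henselian/FiniteFlatHopfAlgebraRankPointCount`: Tate's
count in algebra — over `k` every local factor of `k ⊗_R Γ(G)` sits at a `k`-point and is a translate of the unit factor `k ⊗_R Γ(G⁰)`).
HC_CM is proved only modulo the printed citations until rung 0 closes; this file changes no count.

## References
* [Tate1997FiniteFlatGroupSchemes] J. Tate, *Finite flat group schemes* (1997), (3.7) («`rank G = #G(k̄) · rank G⁰`»).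
* [MumfordAV1970] D. Mumford, *Abelian Varieties* (1970), §12.
-/

set_option autoImplicit false
set_option linter.dupNamespace false  -- `Summit.HodgeConjecture.HodgeConjecture.…` BY DESIGN (D-0017), as in every closer of this cell

noncomputable section

open CategoryTheory CategoryTheory.Limits AlgebraicGeometry MonoidalCategory CartesianMonoidalCategory IsLocalRing

namespace Summit.HodgeConjecture.HodgeConjecture.Cruxes.HLiu418.F0P6bConnectedEtaleStubB1c

/-- **`stub_b1cg_rankEqCardMulRank_geom` (σ2)** — over a henselian local ring `R`, for a finite flat group scheme `G = Spec B` (a group object of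
`Over (Spec R)`) with unit component `j : G₀ = Spec B₀ ↪ G` (a homomorphism whose underlying morphism is an open and closed immersion with
connected source — the line's `IsUnitComponent G G₀ j`, unfolded) and ANY algebraically closed field `k` over `κ(R)` via `φ`:
`rank_R B = #G(k) · rank_R B₀`, `G(k)` the `k`-points of `G` over `Spec R`.  `:=` ★ `GroupSchemes.finrank_eq_natCard_points_mul_finrank_geom`.
[cite: Tate1997FiniteFlatGroupSchemes, (3.7) (p. 141)] [cite: MumfordAV1970, §12] -/
theorem stub_b1cg_rankEqCardMulRank_geom :
    ∀ (R : Type) [CommRing R] [HenselianLocalRing R] (k : Type) [Field k] [IsAlgClosed k] (φ : ResidueField R →+* k)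
      (G G₀ : Over (Spec (.of R))) [GrpObj G] [GrpObj G₀] (j : G₀ ⟶ G),
      IsFinite G.hom → Flat G.hom → (IsMonHom j ∧ IsOpenImmersion j.left ∧ IsClosedImmersion j.left ∧ ConnectedSpace ↥G₀.left) →
        ∀ (B : Type) [CommRing B] [Algebra R B] (eB : G.left ≅ Spec (.of B)),
          eB.hom ≫ Spec.map (CommRingCat.ofHom (algebraMap R B)) = G.hom →
        ∀ (B₀ : Type) [CommRing B₀] [Algebra R B₀] (eB₀ : G₀.left ≅ Spec (.of B₀)),
          eB₀.hom ≫ Spec.map (CommRingCat.ofHom (algebraMap R B₀)) = G₀.hom →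
            Module.finrank R B =
              Nat.card {t : Spec (.of k) ⟶ G.left //
                  t ≫ G.hom = Spec.map (CommRingCat.ofHom (φ.comp (residue R)))} * Module.finrank R B₀ :=
  Literature.AlgebraicGeometry.GroupSchemes.finrank_eq_natCard_points_mul_finrank_geom

/-- **`stub_b1c_rankEqCardMulRank` (σ2)** — the case `k = κ(R)` ALGEBRAICALLY CLOSED: `rank_R B = #G(κ(R)) · rank_R B₀` (the line's ED. 1 letter,
`IsUnitComponent` unfolded).  `:=` ★ `GroupSchemes.finrank_eq_natCard_points_mul_finrank`.
[cite: Tate1997FiniteFlatGroupSchemes, (3.7) (p. 141)] [cite: MumfordAV1970, §12] -/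
theorem stub_b1c_rankEqCardMulRank :
    ∀ (R : Type) [CommRing R] [HenselianLocalRing R] [IsAlgClosed (ResidueField R)]
      (G G₀ : Over (Spec (.of R))) [GrpObj G] [GrpObj G₀] (j : G₀ ⟶ G),
      IsFinite G.hom → Flat G.hom → (IsMonHom j ∧ IsOpenImmersion j.left ∧ IsClosedImmersion j.left ∧ ConnectedSpace ↥G₀.left) →
        ∀ (B : Type) [CommRing B] [Algebra R B] (eB : G.left ≅ Spec (.of B)),
          eB.hom ≫ Spec.map (CommRingCat.ofHom (algebraMap R B)) = G.hom →
        ∀ (B₀ : Type) [CommRing B₀] [Algebra R B₀] (eB₀ : G₀.left ≅ Spec (.of B₀)),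
          eB₀.hom ≫ Spec.map (CommRingCat.ofHom (algebraMap R B₀)) = G₀.hom →
            Module.finrank R B =
              Nat.card {t : Spec (.of (ResidueField R)) ⟶ G.left //
                  t ≫ G.hom = Spec.map (CommRingCat.ofHom (residue R))} * Module.finrank R B₀ :=
  Literature.AlgebraicGeometry.GroupSchemes.finrank_eq_natCard_points_mul_finrank

end Summit.HodgeConjecture.HodgeConjecture.Cruxes.HLiu418.F0P6bConnectedEtaleStubB1c

end
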